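import Summits.ValiantsHypothesis.ValiantsHypothesis.Theorems.DivisionGapPerDivisionHardStubSparseRigidFlow
import Summits.ValiantsHypothesis.ValiantsHypothesis.Theorems.DivisionGapPerDivisionHardStubSparseRigidCount

/-!
# Crux `DivisionGap.PerDivisionHard` (stmt-ValiantsHypothesis-5065), line `pair-descent-jss-endpoint` —
stub `stub_sparseRigid`: K2 for SPARSE cofactors, by counting placements

`stub_sparseRigid`: for all `c d` and all large `n`, every nonzero torus-homogeneous
`h ∈ ℝ≥0[x_ij]` with at most `2^{(log₂ n + c)^c}` monomials admits a placement `eR eC` of the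
block arsenal `G(b,k) ⊕ M₀` with `b ≥ (log₂ n + d)^d`, a weight `w` cutting out the placed face
of the Birkhoff polytope, and a single `G`-part `u` of its top-`w` fibre.

Proof (parameters `L = log₂ n`, `q = (L + c + d + 1)^{c+d+1}`, `b = k = q`, `N = q + q³`
corner rows, `t₀ = 4q + 2`, `n ≥ 16 q³`).
1. Placement by counting (`Count.exists_goodSubset`, `count_lt`): for an ordered pair of
   monomials `(m₁, m₂)` of `h` let `T(m₁, m₂)` be the set of rows where they differ; the pairs
   with `|T| ≥ t₀` are at most `2^{2(L+c)^c} ≤ 2^{t₀}`, so some `N`-set `R` of rows contains no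
   such `T`; label the rows so that the core and internal labels land in `R`
   (`exists_blockEquiv`), columns arbitrarily.
2. The generic weight `w = W` on `G`, `W - B^{rank e}` off `G` (`B = deg h + 1`) cuts out `G`
   (`cutsOut_genericWeight`; the placed graph contains the diagonal perfect matching
   `diagMatch`), and its top fibre agrees off `G` (`eq_offG_of_mem_support_topComponent`).
3. Two monomials `m₁ ≠ m₂` of the top fibre then differ by an integer matrix `D` supported on
   `G` with vanishing row and column sums (equal margins); by the girth substitute
   (`Flow.placedFlow_card_rows`, `placedFlow_row_notPadding`) `D` occupies `≥ 4k + 2 = t₀` rows,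
   all of them corner rows, i.e. `T(m₁, m₂) ⊆ R` with `|T| ≥ t₀` — excluded by step 1.  So the
   top fibre is a single monomial `m₀`, and `u = m₀|_G`.
-/

noncomputable section

-- `Summit.ValiantsHypothesis.ValiantsHypothesis.…` is the tree's mandated single-conjunct layout
-- (Sub = Summit), so the duplicated namespace component is intended.
set_option linter.dupNamespace false

namespace Summit.ValiantsHypothesis.ValiantsHypothesis.Theorems.DivisionGapPerDivisionHard

open MvPolynomial Literature.Computability.AlgebraicComplexity
open Summit.ValiantsHypothesis.ValiantsHypothesis.Theorems.ZeroOneTransfer.Negative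
open scoped NNReal

variable {b k m : ℕ}

/-! ### A perfect matching of the block arsenal (`k ≥ 1`) -/

/-- The diagonal perfect matching of `G(b,k) ⊕ M₀` for `k ≥ 1` (rows ↦ columns): core row `i`
enters the path `(i, i)`, which is traversed in its used phase (internal row `(i, i, t)` ↦ the
next column); the other paths are in their unused phase (`(i, j, t) ↦ (i, j, t)`); padding is
matched to itself. [folklore] -/
def diagMatch (hk : 0 < k) : BlockV b k m → BlockV b k m
  | Sum.inl i => iv i i ⟨0, hk⟩
  | Sum.inr (Sum.inl (i, j, t)) => if j = i then nextCol i j t else iv i j t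
  | Sum.inr (Sum.inr u) => Sum.inr (Sum.inr u)

/-- Its inverse (columns ↦ rows). [folklore] -/
def diagMatchInv (hk : 0 < k) : BlockV b k m → BlockV b k m
  | Sum.inl j => iv j j ⟨k - 1, Nat.sub_lt hk Nat.one_pos⟩
  | Sum.inr (Sum.inl (i, j, t)) => if j = i then prevRow i j t else iv i j t
  | Sum.inr (Sum.inr u) => Sum.inr (Sum.inr u)

/-- `diagMatchInv` is a left inverse of `diagMatch`. [folklore] -/
theorem diagMatchInv_diagMatch (hk : 0 < k) (r : BlockV b k m) :
    diagMatchInv hk (diagMatch hk r) = r := by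
  rcases r with i | ⟨i, j, t⟩ | u
  · simp only [diagMatch, diagMatchInv, iv, if_true]
    exact prevRow_zero i i hk
  · by_cases hj : j = i
    · subst hj
      simp only [diagMatch, if_true]
      by_cases ht : (t : ℕ) + 1 < k
      · rw [show nextCol j j t = (iv j j ⟨t + 1, ht⟩ : BlockV b k m) from dif_pos ht]
        simp only [diagMatchInv, iv, if_true]
        rw [show (⟨(t : ℕ) + 1, ht⟩ : Fin k) = ⟨(t : ℕ) + 1, ht⟩ from rfl, prevRow_succ j j t ht]
      · rw [show nextCol j j t = (Sum.inl j : BlockV b k m) from dif_neg ht]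
        simp only [diagMatchInv, iv, Sum.inr.injEq, Sum.inl.injEq, Prod.mk.injEq, true_and]
        exact Fin.ext (by simp; omega)
    · simp [diagMatch, diagMatchInv, hj, iv]
  · rfl

/-- `diagMatch` consists of edges of `G(b,k) ⊕ M₀`. [folklore] -/
theorem blockAdj_diagMatch (hk : 0 < k) (r : BlockV b k m) :
    blockAdj b k m r (diagMatch hk r) = true := by
  rcases r with i | ⟨i, j, t⟩ | u
  · simp [diagMatch, iv, blockAdj]
  · by_cases hj : j = i
    · subst hj
      simp only [diagMatch, if_true]
      by_cases ht : (t : ℕ) + 1 < k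
      · rw [show nextCol j j t = (iv j j ⟨t + 1, ht⟩ : BlockV b k m) from dif_pos ht]
        simp [blockAdj]
      · rw [show nextCol j j t = (Sum.inl j : BlockV b k m) from dif_neg ht]
        simp only [blockAdj, decide_eq_true_eq, true_and]
        omega
    · simp [diagMatch, hj, iv, blockAdj]
  · simp [diagMatch, blockAdj]

/-- **`G(b,k) ⊕ M₀` has a perfect matching** (`k ≥ 1`). [folklore] -/
theorem exists_blockMatching (b k m : ℕ) (hk : 0 < k) :
    ∃ g : BlockV b k m ≃ BlockV b k m, ∀ r, blockAdj b k m r (g r) = true :=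
  ⟨Equiv.ofBijective _
      (Function.LeftInverse.injective (diagMatchInv_diagMatch hk)).bijective_of_finite,
    fun r => blockAdj_diagMatch hk r⟩

/-! ### The stub -/

variable {n : ℕ}

/-- A permutation inside the placed block graph from a perfect matching of the label graph.
[folklore] -/
theorem exists_perm_mem_placedBlock (eR eC : BlockV b k m ≃ Fin n)
    (g : BlockV b k m ≃ BlockV b k m) (hg : ∀ r, blockAdj b k m r (g r) = true) :
    ∃ σ : Equiv.Perm (Fin n), ∀ x, (σ x, x) ∈ placedBlock eR eC := by
  refine ⟨eC.symm.trans (g.symm.trans eR), fun x => ?_⟩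
  simp only [placedBlock, Finset.mem_filter, Finset.mem_univ, true_and, Equiv.trans_apply,
    Equiv.symm_apply_apply]
  simpa using hg (g.symm (eC.symm x))

/-- The difference of two exponent vectors with equal row and column margins has vanishing row
and column sums. [folklore] -/
theorem sum_diff_eq_zero {m₁ m₂ : (Fin n × Fin n) →₀ ℕ} (hr : rowDegrees m₁ = rowDegrees m₂)
    (hc : Finsupp.mapDomain Prod.snd m₁ = Finsupp.mapDomain Prod.snd m₂) :
    (∀ r, ∑ c, ((m₁ (r, c) : ℤ) - m₂ (r, c)) = 0) ∧
      ∀ c, ∑ r, ((m₁ (r, c) : ℤ) - m₂ (r, c)) = 0 := by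
  refine ⟨fun r => ?_, fun c => ?_⟩
  · rw [Finset.sum_sub_distrib, ← Nat.cast_sum, ← Nat.cast_sum, ← rowDegrees_apply,
      ← rowDegrees_apply, hr, sub_self]
  · rw [Finset.sum_sub_distrib, ← Nat.cast_sum, ← Nat.cast_sum, ← colDegrees_apply,
      ← colDegrees_apply, hc, sub_self]

/-- **`stub_sparseRigid` (K2 of line `pair-descent-jss-endpoint` for SPARSE cofactors).**  For
all `c d` there is `n₀` such that for `n ≥ n₀` every nonzero torus-homogeneous
`h ∈ ℝ≥0[x_ij]` with at most `2^{(log₂ n + c)^c}` monomials admits a placement `eR eC` of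
`G(b,k) ⊕ M₀` with `(log₂ n + d)^d ≤ b`, a weight `w` cutting out the placed face, and a single
`G`-part `u` of the top-`w` fibre of `h` (which is in fact a single monomial).  Placement by
counting over the `≤ 2^{2(log₂ n+c)^c}` ordered pairs of monomials, generic weight, girth
substitute `4k + 2`. [folklore] -/
theorem stub_sparseRigid :
    ∀ c d : ℕ, ∃ n₀ : ℕ, ∀ n ≥ n₀, ∀ h : MvPolynomial (Fin n × Fin n) ℝ≥0,
      h ≠ 0 → IsTorusHomogeneous h → h.support.card ≤ 2 ^ ((Nat.log 2 n + c) ^ c) →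
      ∃ (b k m : ℕ) (eR eC : BlockV b k m ≃ Fin n) (w : Fin n × Fin n → ℕ)
        (u : (Fin n × Fin n) →₀ ℕ),
        (Nat.log 2 n + d) ^ d ≤ b ∧ CutsOut w (placedBlock eR eC) ∧
          HasSingleGPart (placedBlock eR eC) w h u := by
  intro c d
  obtain ⟨L₀, hL₀⟩ := growth (c + d)
  refine ⟨2 ^ (L₀ + 1), fun n hn h hh htor hcard => ?_⟩
  -- the parameters
  have hn0 : n ≠ 0 := by
    have : 1 ≤ 2 ^ (L₀ + 1) := Nat.one_le_two_pow
    omega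
  have hLL₀ : L₀ + 1 ≤ Nat.log 2 n := Nat.le_log_of_pow_le one_lt_two hn
  have h2L : 2 ^ Nat.log 2 n ≤ n := Nat.pow_log_le_self 2 hn0
  have hq16 := hL₀ (Nat.log 2 n) (by omega)
  set L := Nat.log 2 n with hL
  have hy : 2 ≤ L + (c + d) + 1 := by omega
  have hdq : (L + d) ^ d ≤ (L + (c + d) + 1) ^ (c + d + 1) :=
    (Nat.pow_le_pow_left (by omega) d).trans (Nat.pow_le_pow_right (by omega) (by omega))
  have hcq : (L + c) ^ c ≤ (L + (c + d) + 1) ^ (c + d + 1) :=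
    (Nat.pow_le_pow_left (by omega) c).trans (Nat.pow_le_pow_right (by omega) (by omega))
  have hq2 : 2 ≤ (L + (c + d) + 1) ^ (c + d + 1) :=
    (Nat.le_self_pow (Nat.succ_ne_zero _) 2).trans (Nat.pow_le_pow_left hy _)
  set q := (L + (c + d) + 1) ^ (c + d + 1) with hq
  have hQ : 4 * q ≤ q * (q * q) := Nat.mul_comm 4 q ▸ Nat.mul_le_mul_left q (Nat.mul_le_mul hq2 hq2)
  have hk : 0 < q := by omega
  -- bad pairs of monomials: those differing in at least `4q + 2` rows
  let T : ((Fin n × Fin n) →₀ ℕ) × ((Fin n × Fin n) →₀ ℕ) → Finset (Fin n) := fun p =>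
    Finset.univ.filter fun r => ∃ col, p.1 (r, col) ≠ p.2 (r, col)
  set P := (h.support ×ˢ h.support).filter fun p => 4 * q + 2 ≤ (T p).card with hP
  have hPcard : P.card ≤ 2 ^ (4 * q + 2) :=
    calc P.card ≤ (h.support ×ˢ h.support).card := Finset.card_filter_le _ _
      _ = h.support.card * h.support.card := Finset.card_product _ _
      _ ≤ 2 ^ ((L + c) ^ c) * 2 ^ ((L + c) ^ c) := Nat.mul_le_mul hcard hcard
      _ = 2 ^ (2 * (L + c) ^ c) := by rw [two_mul, pow_add]
      _ ≤ 2 ^ (4 * q + 2) := Nat.pow_le_pow_right two_pos (by omega)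
  -- a good set of `N = q + q³` corner rows and the placement
  obtain ⟨R, hRcard, hRgood⟩ := exists_goodSubset P T (q + q * (q * q)) (4 * q + 2)
    (fun p hp => (Finset.mem_filter.mp hp).2)
    (by rw [Fintype.card_fin]; exact count_lt (by omega) (by omega) hPcard (by omega))
  obtain ⟨eR, heR₁, heR₂⟩ :=
    exists_blockEquiv R q q (n - (q + q * (q * q))) hRcard (by rw [hRcard])
  set G := placedBlock eR eR with hG
  set B := h.totalDegree + 1 with hB
  -- the generic weight cuts out `G`
  obtain ⟨g, hg⟩ := exists_blockMatching q q (n - (q + q * (q * q))) hk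
  obtain ⟨σ₀, hσ₀⟩ := exists_perm_mem_placedBlock eR eR g hg
  have hcut : CutsOut (genericWeight G B) G := cutsOut_genericWeight G (Nat.succ_pos _) σ₀ hσ₀
  -- the top fibre is a single monomial
  have hfib : ∀ m₁ ∈ (topComponent (genericWeight G B) h).support,
      ∀ m₂ ∈ (topComponent (genericWeight G B) h).support, m₁ = m₂ := by
    intro m₁ hm₁ m₂ hm₂
    have hs₁ := support_topComponent_subset _ h hm₁
    have hs₂ := support_topComponent_subset _ h hm₂
    obtain ⟨r₀, c₀, hrc⟩ := htor
    have hoff := eq_offG_of_mem_support_topComponent G hm₁ hm₂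
      (degree_eq_of_rowDegrees_eq ((hrc m₁ hs₁).1.trans (hrc m₂ hs₂).1.symm))
    by_contra hne
    -- the difference `D = m₁ - m₂`: supported on `G`, vanishing margins, nonzero
    obtain ⟨hrow, hcol⟩ := sum_diff_eq_zero ((hrc m₁ hs₁).1.trans (hrc m₂ hs₂).1.symm)
      ((hrc m₁ hs₁).2.trans (hrc m₂ hs₂).2.symm)
    have hDG : ∀ e, (fun e => (m₁ e : ℤ) - m₂ e) e ≠ 0 → e ∈ G := fun e he => by
      by_contra heG
      exact he (by simp only [hoff e heG, sub_self])
    have hDne : ∃ e, (fun e => (m₁ e : ℤ) - m₂ e) e ≠ 0 := by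
      by_contra hall
      push Not at hall
      exact hne (Finsupp.ext fun e => by exact_mod_cast sub_eq_zero.mp (hall e))
    have hrows := placedFlow_card_rows eR eR hk hDG hrow hcol hDne
    have hTD : T (m₁, m₂) = Finset.univ.filter fun r => ∃ c', (m₁ (r, c') : ℤ) - m₂ (r, c') ≠ 0 := by
      simp only [T, ne_eq, sub_eq_zero, Nat.cast_inj]
    -- so `(m₁, m₂)` is a bad pair whose rows lie in `R`: excluded by the choice of `R`
    have hmem : (m₁, m₂) ∈ P :=
      Finset.mem_filter.mpr ⟨Finset.mk_mem_product hs₁ hs₂, by rw [hTD]; exact hrows⟩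
    refine hRgood _ hmem fun r hr => ?_
    rw [hTD] at hr
    obtain ⟨c', hc'⟩ := (Finset.mem_filter.mp hr).2
    have hpad := placedFlow_row_notPadding eR eR hDG hrow hcol hc'
    obtain ⟨x, rfl⟩ := eR.surjective r
    rcases x with i | p | u
    · exact heR₁ i
    · exact heR₂ p
    · exact absurd (eR.symm_apply_apply _) (hpad u)
  -- conclusion: `u` is the `G`-part of the unique monomial of the top fibre
  obtain ⟨m₀, hm₀⟩ := support_nonempty.mpr (topComponent_ne_zero (genericWeight G B) hh)
  refine ⟨q, q, n - (q + q * (q * q)), eR, eR, genericWeight G B, m₀.filter (· ∈ G), hdq, hcut,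
    fun e he => ?_, fun m' hm' e he => ?_⟩
  · rw [Finsupp.support_filter] at he
    exact (Finset.mem_filter.mp he).2
  · rw [hfib m' hm' m₀ hm₀, Finsupp.filter_apply_pos _ _ he]

end Summit.ValiantsHypothesis.ValiantsHypothesis.Theorems.DivisionGapPerDivisionHard

end
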